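import Literature.MathematicalPhysics.QuantumFieldTheory.Balaban1983to89.B9SectBQSizesY
import Literature.MathematicalPhysics.QuantumFieldTheory.Balaban1983to89.B9SectBGClassLettersY

/-!
# Balaban [B9], (3.80)–(3.81) pp. 406–407 — THE (3.81) BLOCK MAJORANTS OF THE VARIATIONS `F₂(A) = Q(U′U) − Q(U)`, `F₂*(A) = Q*(U′U) − Q*(U)` AT NODE 00's
# LETTERS UNDER THE DISPLAYED BOND-TRANSPORTER VARIATION LAW `VarParBY`: ★★ `hasMajorant_F₂C`, ★★ `hasMajorant_F₂sC`
# (pub-ymgap N06 G-side plan, Route L, L-4c: the field `hF₂` of `B9SectBGFrameV5.GFrame₅` for the instance `gFrame₅CodedOn`)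

T. Bałaban, *Propagators for lattice gauge theories in a background field*, Commun. Math. Phys. **99** (1985) 389–434
[`Balaban1985BackgroundPropagators`, "B9"]; [4] = T. Bałaban, *Propagators and renormalization transformations for lattice gauge
theories. II*, Commun. Math. Phys. **96** (1984) 223–250 [`Balaban1984PropagatorsII`].

statement-level skeleton of published theorems with citation tags; proofs where landed; nothing here is a claim about the
Yang–Mills mass gap

THE PRINTED LOCUS (p. 406–407): *«Q(U′U) = Q(U) + F₂(A), Q*(U′U) = Q*(U) + F₂*(A), |F₂(A)|, |F₂*(A)| ≦ O(1)α₁»* (the averaging transporters of `e^{iηA}U`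
differ from those of `U` by `O(α₁)` along the contours, by (3.37)).

WHY THIS FILE (seat dag-n06-c gen 13).  The field `hF₂` of r06's G frame asks block majorants `cFb·α₁·e^{−δd}` of the frame letters `F₂ U U′`, `F₂s U U′` on
the class (3.37).  For the instance letters `F₂C ∕ F₂sC` of `B9SectBGWordDeltaAY` (differences of `QbC` ∕ `QsbC` at a (base, multiplier) pair) THIS FILE proves
them under the named law `B9SectBGClassLettersY.VarParBY` (the bond twin of gen 12's `VarParY`: the adjoint actions of the contour transporters of `e^{iηa}U` and
`U` differ by `≦ c_var·β` in operator norm), with the locality and volume bookkeeping of `B9SectBQSizesY`: ★★ `hasMajorant_F₂C` (`(M₂Σ_j‖b_j‖)·c_var·β·e^{δ(ℓ+3)}·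
e^{−δd}`, `sum_abs_qK_eq_one`), ★★ `hasMajorant_F₂sC` (`·2L^{d+1}`, `sum_abs_qsK_le` + level window).

HONEST SCOPE.  Finite-dimensional bookkeeping on DEFINED kernels under a displayed law; nothing of [B9]'s analysis asserted; count-neutral; N06 NOT discharged;
nothing continuum ∕ OS ∕ mass-gap ∕ Clay.  No `sorry`, no `axiom`, no `def`, no `instance`.  `--supports stmt-QuantumFields-27364`.

RELATED IN THE TREE, NOT DUPLICATED: `B9SectBQSizesY` (gen 13 — USED), `B9SectBKerFrameCodedY.hasMajorantHom_FcC` (gen 12: the site-sector (3.57) twin),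
`B9SectBGClassLettersY.VarParBY` (the law — USED).
-/

noncomputable section

namespace Literature.MathematicalPhysics.QuantumFieldTheory.Balaban1983to89.B9SectBQVariationY

open Literature.MathematicalPhysics.QuantumFieldTheory.Balaban1983to89
open Literature.MathematicalPhysics.QuantumFieldTheory.Balaban1983to89.Node00 (SiteY BlkY FBondY IBondY CfgY BondParY UboxY shiftY qT qK qsK QY QsY liftY
  liftY_apply liftMatY liftMatY_diagonal_apply trLiftY_apply QbY QbY_apply_repBondY QbY_apply_of_not_mem_range repBondY resBondY resBondY_apply
  bondCoordsY bondFunCoordsY bondCoordsY_apply geo9K_dist_lab_of_qK_ne_zero geo9K_dist_lab_of_qsK_ne_zero levY)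
open Literature.MathematicalPhysics.QuantumFieldTheory.Balaban1983to89.Node00.OpsYNablaBridge (chartY)
open Literature.MathematicalPhysics.QuantumFieldTheory.Balaban1983to89.B6Ineq2142KLevelV1 (β lvl)
open Literature.MathematicalPhysics.QuantumFieldTheory.Balaban1983to89.B6KLevelCensusIndexV1 (KIdx kGeo)
open Literature.MathematicalPhysics.QuantumFieldTheory.Balaban1983to89.B6RandomWalk (HasMajorant hasMajorant_mono)
open Literature.MathematicalPhysics.QuantumFieldTheory.Balaban1983to89.B9Thm34Ext (toB6)
open Literature.MathematicalPhysics.QuantumFieldTheory.Balaban1983to89.B9GeoNormsKLevelV1 (geo9K)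
open Literature.MathematicalPhysics.QuantumFieldTheory.Balaban1983to89.B9GeoLemma21KLevelV1 (geo9K_dist_comm)
open Literature.MathematicalPhysics.QuantumFieldTheory.Balaban1983to89.B9Eq39Adjoint (R)
open Literature.MathematicalPhysics.QuantumFieldTheory.Balaban1983to89.B9Eq352DivFormLetters (conj)
open Literature.MathematicalPhysics.QuantumFieldTheory.Balaban1983to89.B9Eq360DeltaPrimeAY (blkY AfldY)
open Literature.MathematicalPhysics.QuantumFieldTheory.Balaban1983to89.B9SectBGpLettersY (decY decY_base blkC)
open Literature.MathematicalPhysics.QuantumFieldTheory.Balaban1983to89.B9SectBGpReadingsY (hasMajorant_conj_of_liftY_bound)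
open Literature.MathematicalPhysics.QuantumFieldTheory.Balaban1983to89.B9SectBCodedCarrier (CCfg)
open Literature.MathematicalPhysics.QuantumFieldTheory.Balaban1983to89.B9Eq3132Ineq2142Covariant (qK_apply)
open Literature.MathematicalPhysics.QuantumFieldTheory.Balaban1983to89.B9Thm310CommutatorBound389B (sum_abs_qsK_le)
open Literature.MathematicalPhysics.QuantumFieldTheory.Balaban1983to89.B9Eq3104CommutatorSizesAvg (sum_abs_qK_eq_one)
open Literature.MathematicalPhysics.QuantumFieldTheory.Balaban1983to89.B9SectBGWordDeltaAY (bondOpCoordsRY bondOpCoordsRY_apply restrictScalars_bondOpCoordsY volY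
  volY_pos QsbVY QbC QsbC F₂C F₂sC)
open Literature.MathematicalPhysics.QuantumFieldTheory.Balaban1983to89.B9SectBGReadCodedY (hasMajorant_of_eq)
open Literature.MathematicalPhysics.QuantumFieldTheory.Balaban1983to89.B9SectBQSizesY (bondFunCoordsY_symm_liftY norm_real_smul_le one_le_exp_mul_exp_neg
  volY_le_of_qK_ne_zero)

variable {d ℓ : ℕ} {hd : 1 ≤ d + 1} {hL : Odd (ℓ + 1) ∧ 1 < ℓ + 1} {b₀ b₁ : ℝ}
variable {𝔸 : Type} [NormedRing 𝔸] [NormedAlgebra ℂ 𝔸] [CompleteSpace 𝔸]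
variable {ι : Type} [Fintype ι]
variable (i : KIdx d ℓ hd hL b₀ b₁) (parB : BondParY 𝔸 i) (b : Module.Basis ι ℝ 𝔸) (ιB : BlkY i → IBondY i)
  [Fintype (geo9K i).Site] {Rr : ℝ} {Hp : Prop}

/-! ## ★★ The (3.80)–(3.81) variations under the law `VarParBY` -/


/-- ★★ **THE (3.81) BLOCK MAJORANT OF `F₂(A) = Q(e^{iηa}U) − Q(U)`** under the bond-transporter variation law at `(U, a)` with `(c_var, β)` and contractive
transporters of `U`: for every `δ ≥ 0`, `F₂C (base U) (mult a) ≺ (M₂Σ_j‖b_j‖)·(c_var·β)·e^{δ(ℓ+3)}·e^{−δ·d}` — print's `|F₂(A)| ≦ O(1)α₁`.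
[cite: Balaban1985BackgroundPropagators, (3.80)–(3.81) pp.406–407; Balaban1984PropagatorsII, (2.51) p.232] -/
theorem hasMajorant_F₂C (hι : ∀ s : BlkY i, β i.hN i.D i.hk (ιB s) = s) {M₂ : ℝ} (hM₂ : 0 ≤ M₂)
    (hrepr : ∀ (v : 𝔸) (j : ι), |b.repr v j| ≤ M₂ * ‖v‖) {U : CfgY 𝔸 i} {a : AfldY 𝔸 i} {cVar βv : ℝ} (hcv : 0 ≤ cVar * βv)
    (hvar : B9SectBGClassLettersY.VarParBY i parB cVar βv U a) {δ : ℝ} (hδ : 0 ≤ δ) :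
    HasMajorant (g := toB6 (geo9K i) Rr Hp) (fun q : (Fin (d + 1) × SiteY i) × ι => blkC i ιB q.1.2)
      (F₂C i parB b (.base U) (.mult a))
      (fun a a' => (M₂ * ∑ j, ‖b j‖) * (cVar * βv * Real.exp (δ * ((ℓ : ℝ) + 3)) * Real.exp (-(δ * (geo9K i).dist a a')))) := by
  classical
  set W := decY i (.prod U a) with hW
  have hQ : F₂C i parB b (.base U) (.mult a) = conj b (bondOpCoordsRY i ((QbY i parB W - QbY i parB U).restrictScalars ℝ)) := by
    simp only [F₂C, QbC, restrictScalars_bondOpCoordsY, decY_base, ← B9Eq352DivFormLetters.conj_sub, ← map_sub]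
    rfl
  refine hasMajorant_of_eq i hQ (hasMajorant_conj_of_liftY_bound b (g := toB6 (geo9K i) Rr Hp) (fun z : Fin (d + 1) × SiteY i => blkC i ιB z.2)
    _ _ M₂ hM₂ hrepr fun f E y' B hE hB hoff hbd z => ?_)
  rw [bondOpCoordsRY_apply, LinearMap.restrictScalars_apply, Node00.bondFunCoordsY_apply, LinearMap.sub_apply]
  set Λ : FBondY i → 𝔸 := (bondFunCoordsY i).symm (liftY f E) with hΛ
  have hΛf : ∀ f' : FBondY i, ‖Λ f'‖ ≤ |f (bondCoordsY i f')| := fun f' => by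
    rw [hΛ, bondFunCoordsY_symm_liftY]; exact norm_real_smul_le hE
  have hK0 : 0 ≤ cVar * βv * Real.exp (δ * ((ℓ : ℝ) + 3)) * Real.exp (-(δ * (geo9K i).dist (blkC i ιB z.2) y')) * B := by positivity
  by_cases hz : (bondCoordsY i).symm z ∈ Set.range (repBondY i)
  · obtain ⟨κ, hκ⟩ := hz
    rw [Pi.sub_apply, ← hκ, QbY_apply_repBondY, QbY_apply_repBondY]
    have hz2 : z.2 = B6GlobalChartV1.boxEquiv i.hN (repBondY i κ).src := by
      have : z = bondCoordsY i (repBondY i κ) := by rw [hκ, Equiv.apply_symm_apply]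
      rw [this, bondCoordsY_apply]
    -- the difference of the two averages, termwise
    have hval : QY i parB W Λ κ - QY i parB U Λ κ =
        ∑ f', ((qK i κ f' : ℝ) : ℂ) • (R (qT i parB W κ f') (Λ f') - R (qT i parB U κ f') (Λ f')) := by
      simp only [QY, trLiftY_apply, smul_sub, Finset.sum_sub_distrib]
    have hterm : ∀ f', ‖((qK i κ f' : ℝ) : ℂ) • (R (qT i parB W κ f') (Λ f') - R (qT i parB U κ f') (Λ f'))‖ ≤
        |qK i κ f'| * (cVar * βv * |f (bondCoordsY i f')|) := by
      intro f'
      by_cases hq : qK i κ f' = 0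
      · rw [hq, Complex.ofReal_zero, zero_smul, norm_zero, abs_zero, zero_mul]
      · rw [norm_smul, Complex.norm_real, Real.norm_eq_abs]
        exact mul_le_mul_of_nonneg_left ((hvar κ f' hq (Λ f')).1.trans (mul_le_mul_of_nonneg_left (hΛf f') hcv)) (abs_nonneg _)
    rw [hval]
    by_cases hex : ∃ f' : FBondY i, qK i κ f' ≠ 0 ∧ blkC i ιB (B6GlobalChartV1.boxEquiv i.hN f'.src) = y'
    · obtain ⟨f₀, hf₀, hy'⟩ := hex
      have hdist : (geo9K i).dist (blkC i ιB z.2) y' ≤ (ℓ : ℝ) + 3 := by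
        rw [hz2, ← hy']; exact geo9K_dist_lab_of_qK_ne_zero i ιB hι hf₀
      have hsum : ‖∑ f', ((qK i κ f' : ℝ) : ℂ) • (R (qT i parB W κ f') (Λ f') - R (qT i parB U κ f') (Λ f'))‖ ≤
          ∑ f', |qK i κ f'| * (cVar * βv * B) :=
        (norm_sum_le _ _).trans (Finset.sum_le_sum fun f' _ => (hterm f').trans
          (mul_le_mul_of_nonneg_left (mul_le_mul_of_nonneg_left (hbd _) hcv) (abs_nonneg _)))
      rw [← Finset.sum_mul, sum_abs_qK_eq_one, one_mul] at hsum
      calc ‖∑ f', ((qK i κ f' : ℝ) : ℂ) • (R (qT i parB W κ f') (Λ f') - R (qT i parB U κ f') (Λ f'))‖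
          ≤ cVar * βv * 1 * B := by rw [mul_one]; exact hsum
        _ ≤ cVar * βv * (Real.exp (δ * ((ℓ : ℝ) + 3)) * Real.exp (-(δ * (geo9K i).dist (blkC i ιB z.2) y'))) * B := by
            gcongr; exact one_le_exp_mul_exp_neg hδ hdist
        _ = _ := by ring
    · have hsum : ‖∑ f', ((qK i κ f' : ℝ) : ℂ) • (R (qT i parB W κ f') (Λ f') - R (qT i parB U κ f') (Λ f'))‖ ≤ ∑ f' : FBondY i, (0 : ℝ) := by
        refine (norm_sum_le _ _).trans (Finset.sum_le_sum fun f' _ => (hterm f').trans ?_)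
        by_cases hq : qK i κ f' = 0
        · rw [hq, abs_zero, zero_mul]
        · have hoff' : f (bondCoordsY i f') = 0 := by
            refine hoff _ fun h => hex ⟨f', hq, ?_⟩
            rw [← h, bondCoordsY_apply]
          rw [hoff', abs_zero, mul_zero, mul_zero]
      rw [Finset.sum_const_zero] at hsum
      exact hsum.trans hK0
  · rw [Pi.sub_apply, QbY_apply_of_not_mem_range i parB W Λ hz, QbY_apply_of_not_mem_range i parB U Λ hz, sub_zero, norm_zero]
    exact hK0

/-- ★★ **THE (3.81) BLOCK MAJORANT OF `F₂*(A) = Q*(e^{iηa}U) − Q*(U)`** (print's weighted adjoint, `QsbVY`) under the bond-transporter variation law at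
`(U, a)` with `(c_var, β)`: for every `δ ≥ 0`, `F₂sC (base U) (mult a) ≺ (M₂Σ_j‖b_j‖)·(c_var·β·2L^{d+1})·e^{δ(ℓ+3)}·e^{−δ·d}`.
[cite: Balaban1985BackgroundPropagators, (3.80)–(3.81) pp.406–407, (3.13) p.393; Balaban1984PropagatorsII, (2.51) p.232] -/
theorem hasMajorant_F₂sC (hι : ∀ s : BlkY i, β i.hN i.D i.hk (ιB s) = s) {M₂ : ℝ} (hM₂ : 0 ≤ M₂)
    (hrepr : ∀ (v : 𝔸) (j : ι), |b.repr v j| ≤ M₂ * ‖v‖) {U : CfgY 𝔸 i} {a : AfldY 𝔸 i} {cVar βv : ℝ} (hcv : 0 ≤ cVar * βv)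
    (hvar : B9SectBGClassLettersY.VarParBY i parB cVar βv U a) {δ : ℝ} (hδ : 0 ≤ δ) :
    HasMajorant (g := toB6 (geo9K i) Rr Hp) (fun q : (Fin (d + 1) × SiteY i) × ι => blkC i ιB q.1.2)
      (F₂sC i parB b (.base U) (.mult a))
      (fun a a' => (M₂ * ∑ j, ‖b j‖) *
        (cVar * βv * (2 * (((ℓ + 1 : ℕ) : ℝ)) ^ (d + 1)) * Real.exp (δ * ((ℓ : ℝ) + 3)) * Real.exp (-(δ * (geo9K i).dist a a')))) := by
  classical
  set W := decY i (.prod U a) with hW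
  have hQ : F₂sC i parB b (.base U) (.mult a) = conj b (bondOpCoordsRY i ((QsbVY i parB W - QsbVY i parB U).restrictScalars ℝ)) := by
    simp only [F₂sC, QsbC, restrictScalars_bondOpCoordsY, decY_base, ← B9Eq352DivFormLetters.conj_sub, ← map_sub]
    rfl
  refine hasMajorant_of_eq i hQ (hasMajorant_conj_of_liftY_bound b (g := toB6 (geo9K i) Rr Hp) (fun z : Fin (d + 1) × SiteY i => blkC i ιB z.2)
    _ _ M₂ hM₂ hrepr fun f E y' B hE hB hoff hbd z => ?_)
  rw [bondOpCoordsRY_apply, LinearMap.restrictScalars_apply, Node00.bondFunCoordsY_apply, LinearMap.sub_apply, Pi.sub_apply]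
  set Λ : FBondY i → 𝔸 := (bondFunCoordsY i).symm (liftY f E) with hΛ
  set bd : FBondY i := (bondCoordsY i).symm z with hbd'
  have hz2 : z.2 = B6GlobalChartV1.boxEquiv i.hN bd.src := by
    have : z = bondCoordsY i bd := by rw [hbd', Equiv.apply_symm_apply]
    rw [this, bondCoordsY_apply]
  set LL : ℝ := (((ℓ + 1 : ℕ) : ℝ)) ^ (d + 1) with hLL
  have hL1 : (1 : ℝ) ≤ LL := one_le_pow₀ (by exact_mod_cast Nat.succ_le_succ (Nat.zero_le ℓ))
  set J₀ : ℕ := levY i (chartY i bd.src) with hJ₀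
  have hK0 : 0 ≤ cVar * βv * (2 * LL) * Real.exp (δ * ((ℓ : ℝ) + 3)) * Real.exp (-(δ * (geo9K i).dist (blkC i ιB z.2) y')) * B := by
    positivity
  have hval : QsbVY i parB W Λ bd - QsbVY i parB U Λ bd =
      ∑ κ, ((qsK i bd κ : ℝ) : ℂ) • (R (qT i parB W κ bd)⁻¹ (((volY i κ : ℝ) : ℂ) • Λ (repBondY i κ)) -
        R (qT i parB U κ bd)⁻¹ (((volY i κ : ℝ) : ℂ) • Λ (repBondY i κ))) := by
    simp only [QsbVY, LinearMap.comp_apply, QsY, trLiftY_apply, liftMatY_diagonal_apply, resBondY_apply, smul_sub, Finset.sum_sub_distrib]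
  have hΛrep : ∀ κ, ‖((volY i κ : ℝ) : ℂ) • Λ (repBondY i κ)‖ ≤ volY i κ * |f (bondCoordsY i (repBondY i κ))| := fun κ => by
    rw [norm_smul, Complex.norm_real, Real.norm_eq_abs, abs_of_pos (volY_pos i κ), hΛ, bondFunCoordsY_symm_liftY]
    exact mul_le_mul_of_nonneg_left (norm_real_smul_le hE) (volY_pos i κ).le
  have hterm : ∀ κ, ‖((qsK i bd κ : ℝ) : ℂ) • (R (qT i parB W κ bd)⁻¹ (((volY i κ : ℝ) : ℂ) • Λ (repBondY i κ)) -
        R (qT i parB U κ bd)⁻¹ (((volY i κ : ℝ) : ℂ) • Λ (repBondY i κ)))‖ ≤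
      |qsK i bd κ| * (cVar * βv * (volY i κ * |f (bondCoordsY i (repBondY i κ))|)) := by
    intro κ
    by_cases hq : qsK i bd κ = 0
    · rw [hq, Complex.ofReal_zero, zero_smul, norm_zero, abs_zero, zero_mul]
    · have hq' : qK i κ bd ≠ 0 := by rw [Node00.qsK_eq_transpose, Matrix.transpose_apply] at hq; exact hq
      rw [norm_smul, Complex.norm_real, Real.norm_eq_abs]
      exact mul_le_mul_of_nonneg_left ((hvar κ bd hq' _).2.trans (mul_le_mul_of_nonneg_left (hΛrep κ) hcv)) (abs_nonneg _)
  rw [hval]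
  by_cases hex : ∃ κ, qsK i bd κ ≠ 0 ∧ blkC i ιB (B6GlobalChartV1.boxEquiv i.hN (repBondY i κ).src) = y'
  · obtain ⟨κ₀, hκ₀, hy'⟩ := hex
    have hdist : (geo9K i).dist (blkC i ιB z.2) y' ≤ (ℓ : ℝ) + 3 := by
      rw [hz2, ← hy', geo9K_dist_comm]; exact geo9K_dist_lab_of_qsK_ne_zero i ιB hι hκ₀
    have hsum : ‖∑ κ, ((qsK i bd κ : ℝ) : ℂ) • (R (qT i parB W κ bd)⁻¹ (((volY i κ : ℝ) : ℂ) • Λ (repBondY i κ)) -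
          R (qT i parB U κ bd)⁻¹ (((volY i κ : ℝ) : ℂ) • Λ (repBondY i κ)))‖ ≤
        ∑ κ, |qsK i bd κ| * (cVar * βv * (LL ^ (J₀ + 1) * B)) := by
      refine (norm_sum_le _ _).trans (Finset.sum_le_sum fun κ _ => (hterm κ).trans ?_)
      by_cases hq : qsK i bd κ = 0
      · rw [hq, abs_zero, zero_mul, zero_mul]
      · refine mul_le_mul_of_nonneg_left (mul_le_mul_of_nonneg_left (mul_le_mul ?_ (hbd _) (abs_nonneg _) (by positivity)) hcv) (abs_nonneg _)
        have hq' : qK i κ bd ≠ 0 := by rw [Node00.qsK_eq_transpose, Matrix.transpose_apply] at hq; exact hq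
        exact volY_le_of_qK_ne_zero i hq'
    have hcol : ∑ κ, |qsK i bd κ| ≤ 2 * (LL ^ J₀)⁻¹ := sum_abs_qsK_le i bd
    have hLJ : (0 : ℝ) < LL ^ J₀ := by positivity
    calc ‖∑ κ, ((qsK i bd κ : ℝ) : ℂ) • (R (qT i parB W κ bd)⁻¹ (((volY i κ : ℝ) : ℂ) • Λ (repBondY i κ)) -
            R (qT i parB U κ bd)⁻¹ (((volY i κ : ℝ) : ℂ) • Λ (repBondY i κ)))‖
        ≤ (∑ κ, |qsK i bd κ|) * (cVar * βv * (LL ^ (J₀ + 1) * B)) := by rw [← Finset.sum_mul] at hsum; exact hsum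
      _ ≤ 2 * (LL ^ J₀)⁻¹ * (cVar * βv * (LL ^ (J₀ + 1) * B)) := mul_le_mul_of_nonneg_right hcol (by positivity)
      _ = cVar * βv * (2 * LL) * 1 * B := by rw [pow_succ]; field_simp
      _ ≤ cVar * βv * (2 * LL) * (Real.exp (δ * ((ℓ : ℝ) + 3)) * Real.exp (-(δ * (geo9K i).dist (blkC i ιB z.2) y'))) * B := by
          gcongr; exact one_le_exp_mul_exp_neg hδ hdist
      _ = _ := by ring
  · have hsum : ‖∑ κ, ((qsK i bd κ : ℝ) : ℂ) • (R (qT i parB W κ bd)⁻¹ (((volY i κ : ℝ) : ℂ) • Λ (repBondY i κ)) -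
          R (qT i parB U κ bd)⁻¹ (((volY i κ : ℝ) : ℂ) • Λ (repBondY i κ)))‖ ≤ ∑ κ : IBondY i, (0 : ℝ) := by
      refine (norm_sum_le _ _).trans (Finset.sum_le_sum fun κ _ => (hterm κ).trans ?_)
      by_cases hq : qsK i bd κ = 0
      · rw [hq, abs_zero, zero_mul]
      · have hoff' : f (bondCoordsY i (repBondY i κ)) = 0 := by
          refine hoff _ fun h => hex ⟨κ, hq, ?_⟩
          rw [← h, bondCoordsY_apply]
        rw [hoff', abs_zero, mul_zero, mul_zero, mul_zero]
    rw [Finset.sum_const_zero] at hsum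
    exact hsum.trans hK0



end Literature.MathematicalPhysics.QuantumFieldTheory.Balaban1983to89.B9SectBQVariationY

end
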